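import Mathlib
import Summits.KontsevichZagierPeriods.KontsevichZagierPeriods.Theorems.SoloInformedNonintPoint
import Summits.KontsevichZagierPeriods.KontsevichZagierPeriods.Theorems.SoloInformedAlgReduce
import HarnessLib
import HarnessLib.Audit

/-!
# SoloInformed — NONINT, global form: the polar curve meets the closed domain in finitely many points (PRES-RAT(2), Phase IV-7)

Solo programme `solo-KontsevichZagierPeriods-informed`, session s110.  Let `K ⊆ ℝ` be a field,
`N, D, C ∈ K[x, y]` with `C` squarefree, every irreducible factor of `D` dividing `C` and coprime
to `N`, `Ω ⊆ ℝ²` open with `frontier Ω ⊆ Z(C)`, `D ≠ 0` on `Ω`, and `f = N/D` on `Ω` integrable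
on `Ω`.  Then `Z(D) ∩ closure Ω` is finite (`soloInformed_finite_polarSet_closure`).

Proof.  For an irreducible factor `q` of `D`, all but finitely many real zeros `p` of `q` satisfy
`N(p) ≠ 0`, `(C/q)(p) ≠ 0` and `∇q(p) ≠ 0` (elimination against the irreducible `q`,
file SoloInformedAlgElim); at such a point `C = q · (C/q)` has `∇C(p) ≠ 0`, `Z(C) = Z(q) ⊆ Z(D)`
near `p`, and `p ∈ frontier Ω` as soon as `p ∈ closure Ω` (because `D(p) = 0`).  The smooth-point
NONINT lemma (file SoloInformedNonintPoint) excludes such points, so `Z(q) ∩ closure Ω` is finite;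
induction on the factorisation of `D` concludes.

References: folklore.
-/

noncomputable section

open scoped BigOperators Topology
open MeasureTheory Set Filter Metric

namespace Summit.KontsevichZagierPeriods.KontsevichZagierPeriods.Theorems

variable {K : Type*} [Field K] [Algebra K ℝ]

/-- An irreducible polynomial with a real zero has positive total degree. -/
theorem soloInformed_totalDegree_ne_zero_of_zero {q : MvPolynomial (Fin 2) K} (hq : Irreducible q)
    {x : Fin 2 → ℝ} (hx : (MvPolynomial.aeval x q : ℝ) = 0) : q.totalDegree ≠ 0 := by
  intro h0
  rw [MvPolynomial.totalDegree_eq_zero_iff_eq_C] at h0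
  rw [h0, MvPolynomial.aeval_C] at hx
  have hc : MvPolynomial.coeff 0 q = 0 := (map_eq_zero_iff _ (algebraMap K ℝ).injective).1 hx
  exact hq.ne_zero (by rw [h0, hc, map_zero])

omit [Algebra K ℝ] in
/-- A squarefree polynomial is not divisible by the square of an irreducible: the cofactor of an
irreducible factor is coprime to it. -/
theorem soloInformed_not_dvd_cofactor_of_squarefree {C q r : MvPolynomial (Fin 2) K}
    (hC : Squarefree C) (hq : Irreducible q) (hr : C = q * r) : ¬ q ∣ r := by
  intro h
  obtain ⟨t, ht⟩ := h
  have hqq : q * q ∣ C := ⟨t, by rw [hr, ht, mul_assoc]⟩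
  exact hq.not_isUnit (hC q hqq)

omit [Algebra K ℝ] in
/-- An irreducible polynomial does not divide its own non-zero partial derivative. -/
theorem soloInformed_not_dvd_pderiv_self {q : MvPolynomial (Fin 2) K} {i : Fin 2}
    (hi : MvPolynomial.pderiv i q ≠ 0) : ¬ q ∣ MvPolynomial.pderiv i q :=
  soloInformed_not_dvd_of_degreeOf_lt hi (soloInformed_degreeOf_pderiv_lt hi)

/-- **NONINT for one irreducible factor of the denominator.**  If `q` is an irreducible factor of
`D` dividing the squarefree boundary polynomial `C` and coprime to `N`, then `Z(q)` meets
`closure Ω` in finitely many points. -/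
theorem soloInformed_finite_zeros_closure_of_irreducible {N D C q : MvPolynomial (Fin 2) K}
    {Ω : Set (Fin 2 → ℝ)} {f : (Fin 2 → ℝ) → ℝ}
    (hΩ : IsOpen Ω) (hfr : frontier Ω ⊆ {z | (MvPolynomial.aeval z C : ℝ) = 0})
    (hC : Squarefree C) (hq : Irreducible q) (hqD : q ∣ D) (hqC : q ∣ C) (hqN : ¬ q ∣ N)
    (hD : ∀ z ∈ Ω, (MvPolynomial.aeval z D : ℝ) ≠ 0)
    (hf : EqOn f (fun z => (MvPolynomial.aeval z N : ℝ) / MvPolynomial.aeval z D) Ω)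
    (hint : IntegrableOn f Ω) :
    ({z | (MvPolynomial.aeval z q : ℝ) = 0} ∩ closure Ω).Finite := by
  classical
  by_contra hinf
  change ({z | (MvPolynomial.aeval z q : ℝ) = 0} ∩ closure Ω).Infinite at hinf
  obtain ⟨r, hr⟩ := hqC
  obtain ⟨t, ht⟩ := hqD
  have hqr : ¬ q ∣ r := soloInformed_not_dvd_cofactor_of_squarefree hC hq hr
  -- `q` has positive degree, hence a non-zero partial derivative
  obtain ⟨x₀, hx₀, -⟩ := hinf.nonempty
  have hdeg : q.totalDegree ≠ 0 := soloInformed_totalDegree_ne_zero_of_zero hq hx₀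
  obtain ⟨i, hi⟩ := soloInformed_exists_pderiv_ne_zero hdeg
  -- the three exceptional finite sets
  have hE : ({x : Fin 2 → ℝ | (MvPolynomial.aeval x q : ℝ) = 0 ∧ (MvPolynomial.aeval x N : ℝ) = 0} ∪
      {x | (MvPolynomial.aeval x q : ℝ) = 0 ∧ (MvPolynomial.aeval x r : ℝ) = 0} ∪
      {x | (MvPolynomial.aeval x q : ℝ) = 0 ∧
        (MvPolynomial.aeval x (MvPolynomial.pderiv i q) : ℝ) = 0}).Finite :=
    ((soloInformed_finite_commonZeros hq hqN).union (soloInformed_finite_commonZeros hq hqr)).union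
      (soloInformed_finite_commonZeros hq (soloInformed_not_dvd_pderiv_self hi))
  obtain ⟨p, ⟨hpq, hpcl⟩, hpE⟩ := (hinf.sdiff hE).nonempty
  simp only [mem_union, mem_setOf_eq, not_or, not_and] at hpE
  obtain ⟨⟨hpN, hpr⟩, hpi⟩ := hpE
  replace hpN : (MvPolynomial.aeval p N : ℝ) ≠ 0 := hpN hpq
  replace hpr : (MvPolynomial.aeval p r : ℝ) ≠ 0 := hpr hpq
  replace hpi : (MvPolynomial.aeval p (MvPolynomial.pderiv i q) : ℝ) ≠ 0 := hpi hpq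
  -- `p` is a frontier point
  have hDp : (MvPolynomial.aeval p D : ℝ) = 0 := by
    rw [ht, map_mul, hpq, zero_mul]
  have hpΩ : p ∉ Ω := fun h => hD p h hDp
  have hpf : p ∈ frontier Ω := by
    rw [hΩ.frontier_eq]
    exact ⟨hpcl, hpΩ⟩
  -- `C(p) = 0` and `∇C(p) ≠ 0`
  have hCp : (MvPolynomial.aeval p C : ℝ) = 0 := by
    rw [hr, map_mul, hpq, zero_mul]
  have hCi : (MvPolynomial.aeval p (MvPolynomial.pderiv i C) : ℝ) ≠ 0 := by
    rw [hr, MvPolynomial.pderiv_mul, map_add, map_mul, map_mul, hpq, zero_mul, add_zero]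
    exact mul_ne_zero hpi hpr
  have hgrad : (MvPolynomial.aeval p (MvPolynomial.pderiv 0 C) : ℝ) ≠ 0 ∨
      (MvPolynomial.aeval p (MvPolynomial.pderiv 1 C) : ℝ) ≠ 0 := by
    fin_cases i
    · exact Or.inl hCi
    · exact Or.inr hCi
  -- near `p`, `Z(C) = Z(q) ⊆ Z(D)`
  have hopen : IsOpen {z : Fin 2 → ℝ | (MvPolynomial.aeval z r : ℝ) ≠ 0} :=
    isOpen_ne_fun (soloInformed_continuous_aevalK r) continuous_const
  obtain ⟨ε, hε, hball⟩ := Metric.isOpen_iff.1 hopen p hpr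
  have hloc : ∀ z : Fin 2 → ℝ, |z 0 - p 0| < ε → |z 1 - p 1| < ε →
      (MvPolynomial.aeval z C : ℝ) = 0 → (MvPolynomial.aeval z D : ℝ) = 0 := by
    intro z h0 h1 hCz
    have hz : z ∈ ball p ε := by
      rw [mem_ball, dist_pi_lt_iff hε]
      intro j
      fin_cases j
      · simpa [Real.dist_eq] using h0
      · simpa [Real.dist_eq] using h1
    have hrz : (MvPolynomial.aeval z r : ℝ) ≠ 0 := hball hz
    rw [hr, map_mul] at hCz
    have hqz : (MvPolynomial.aeval z q : ℝ) = 0 := by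
      rcases mul_eq_zero.1 hCz with h | h
      · exact h
      · exact absurd h hrz
    rw [ht, map_mul, hqz, zero_mul]
  exact soloInformed_nonint_smoothPoint hΩ hfr hCp hgrad hε hloc hpf hpN hD hf hint

/-- **NONINT (global).**  Under the standing hypotheses (`C` squarefree, every irreducible factor
of `D` divides `C` and is coprime to `N`), the polar set `Z(D)` meets `closure Ω` in finitely
many points. -/
theorem soloInformed_finite_polarSet_closure {N D C : MvPolynomial (Fin 2) K}
    {Ω : Set (Fin 2 → ℝ)} {f : (Fin 2 → ℝ) → ℝ}
    (hΩ : IsOpen Ω) (hfr : frontier Ω ⊆ {z | (MvPolynomial.aeval z C : ℝ) = 0})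
    (hC : Squarefree C) (hD0 : D ≠ 0)
    (hDC : ∀ q : MvPolynomial (Fin 2) K, Irreducible q → q ∣ D → q ∣ C)
    (hDN : ∀ q : MvPolynomial (Fin 2) K, Irreducible q → q ∣ D → ¬ q ∣ N)
    (hD : ∀ z ∈ Ω, (MvPolynomial.aeval z D : ℝ) ≠ 0)
    (hf : EqOn f (fun z => (MvPolynomial.aeval z N : ℝ) / MvPolynomial.aeval z D) Ω)
    (hint : IntegrableOn f Ω) :
    ({z | (MvPolynomial.aeval z D : ℝ) = 0} ∩ closure Ω).Finite := by
  suffices h : ∀ D' : MvPolynomial (Fin 2) K, D' ∣ D →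
      ({z | (MvPolynomial.aeval z D' : ℝ) = 0} ∩ closure Ω).Finite from h D dvd_rfl
  intro D'
  induction D' using WfDvdMonoid.induction_on_irreducible with
  | zero =>
    intro h
    exact absurd (zero_dvd_iff.1 h) hD0
  | unit u hu =>
    intro _
    have he : {z : Fin 2 → ℝ | (MvPolynomial.aeval z u : ℝ) = 0} ∩ closure Ω = ∅ := by
      ext z
      simp only [mem_inter_iff, mem_setOf_eq, mem_empty_iff_false, iff_false, not_and]
      intro hz
      exact absurd hz (hu.map (MvPolynomial.aeval z)).ne_zero
    rw [he]
    exact finite_empty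
  | mul a i ha hi ih =>
    intro hdvd
    have hiD : i ∣ D := dvd_of_mul_right_dvd hdvd
    have haD : a ∣ D := dvd_of_mul_left_dvd hdvd
    have hsub : {z : Fin 2 → ℝ | (MvPolynomial.aeval z (i * a) : ℝ) = 0} ∩ closure Ω ⊆
        ({z | (MvPolynomial.aeval z i : ℝ) = 0} ∩ closure Ω) ∪
          ({z | (MvPolynomial.aeval z a : ℝ) = 0} ∩ closure Ω) := by
      rintro z ⟨hz, hzc⟩
      simp only [mem_setOf_eq, map_mul, mul_eq_zero] at hz
      rcases hz with h | h
      · exact Or.inl ⟨h, hzc⟩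
      · exact Or.inr ⟨h, hzc⟩
    exact ((soloInformed_finite_zeros_closure_of_irreducible hΩ hfr hC hi hiD (hDC i hi hiD)
      (hDN i hi hiD) hD hf hint).union (ih haD)).subset hsub

end Summit.KontsevichZagierPeriods.KontsevichZagierPeriods.Theorems

end
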